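import Mathlib
import HarnessLib
import Summits.HubbardSuperconductivity.HubbardSuperconductivity.Theorems.ComplexGFFStiffnessHypALocalTwoPointFreeEnergyAllN
import Literature.MathematicalPhysics.StatisticalMechanics.AbkmPackageShrunkSlots
import Literature.MathematicalPhysics.StatisticalMechanics.TorusFRDHolds
import Literature.MathematicalPhysics.StatisticalMechanics.WeightTheoremABKMPackage
import Literature.MathematicalPhysics.StatisticalMechanics.RGStepParamsABKM
import Literature.MathematicalPhysics.StatisticalMechanics.RGStepSigmaLimitABKM
import Literature.MathematicalPhysics.StatisticalMechanics.RGStepSigmaABKM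
import Literature.MathematicalPhysics.StatisticalMechanics.LinearisedMapContrConstDecay

/-!
# Crux `HypALocalTwoPoint`, line `gnv` — `FreeEnergyBounds` from the `q`-regularity slots on the SHRUNK state ball:
# **`F4StatementShrink 4 → H1bcStatementShrink 4 → FreeEnergyBounds`** (census F1 residual = the re-typed route child `F1Residual`, rev 5)

Route `route-HubbardSuperconductivity-ComplexGFFStiffness`, crux item stmt-HubbardSuperconductivity-19155
(`HypALocalTwoPoint`), registered stub `stub_twoPointGivenZ` (⇐ `FreeEnergyBounds`, p817758).  The per-`L`
parameter choice of `gnv_of_torusFRD` ([ABKM19] proof of Theorem 12.1), verbatim except for the regularity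
orders `(n, ñ) = (16, 19)` (gap `d + 1 ≤ 2(ñ − n)` of the `N`-uniform `q`-slots, [Buc16] Thm 4.5): `d = 4`,
`M_ord = R = 8`, `p_Φ = 4`, `r₀ = 3`, `θ̄ = 1/8`, `λ = 1/2`, `θ = 1/16`; per odd `L ≥ L₀` the weight schedule
(`abkm_weight_bounds_of_package`), `h`, `T₀`, `A` (`eventually_atTop_sideConditions`, `exists_sigmaABKM_zero_lt`,
`L^4 C_{8.7} A_𝒫'/A ≤ 1/6`), `r > 0` (`eventually_nhds_ballConditions`, continuity of `σ` — applied at `r` AND at `r/8`); these are bundled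
as ONE `P : PackageData 4`.  The two hypotheses (planner's rev-5 typing, `AbkmPackageShrunkSlots`) give the `N`-free
sizes of the nine `q`-slots and of the state slot of the SHRUNK package `P.shrink` (the same package with state-ball
radius `r/8`; Theorem 6.8 side conditions by monotonicity, `AbkmPackageShrink`), which is itself a `PackageData 4`
with `0 < r/8`, the same `T₀`, `L⁴C_{8.7}A_𝒫'/A ≤ 1/6` and `σ(r/8) ≤ 7/16`; so `freeEnergy_allN_of_slots` APPLIED TO
`P.shrink` (choice of `ρ, ε, ρ_𝒦` after the sizes; the three clauses at every height with one constant) finishes,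
the height-`N` torus data being bundled as `Q : PackageAt P.shrink N M`:

* **`freeEnergyBounds_of_shrunkSlots : F4StatementShrink 4 → H1bcStatementShrink 4 → FreeEnergyBounds`** — by
  definition the route child `…Theses.ComplexGFFStiffness.F1Residual` (rev 5); the full-radius form
  `freeEnergyBounds_of_slots` is the sibling file `…FreeEnergyBoundsOfSlots`.

All proved, no `sorry`.  Honest scope: a CONDITIONAL assembly for a rung route (stiffness of a complex Gaussian
gradient field via the [ABKM19] renormalisation group): `H1bcStatementShrink 4` is a theorem of the tree
(`h1bcStatementShrink_holds`), `F4StatementShrink 4` is open (⇐ `TwoKernelSkBound 4 ∧ F4l2Shrink 4` by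
`f4StatementShrink_of_cores`); nothing about superconductivity in the Hubbard model.

## References
* S. Adams, S. Buchholz, R. Kotecký, S. Müller, arXiv:1910.13564, Thm 2.2, Ch. 4 (4.4)–(4.12), Lemma 12.6,
  proof of Thm 12.1 [AdamsBuchholzKoteckyMuller2019].
* S. Buchholz, J. Funct. Anal. 275 (2018), Thm 2.4 / Thm 4.5 [Buchholz2016].
-/

noncomputable section

-- `Summit.<Summit>.<Problem>`: single-conjunct summit, the duplicate component is mandated (D-0017).
set_option linter.dupNamespace false

namespace Summit.HubbardSuperconductivity.HubbardSuperconductivity.Theorems.ComplexGFF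

open scoped BigOperators ComplexConjugate Topology
open Real Set Finset MeasureTheory Filter
open Literature.MathematicalPhysics.StatisticalMechanics.GradientRG
open Literature.MathematicalPhysics.StatisticalMechanics.GradientFRD
  (fourierCoeff IsElliptic IsUnitSymm InShell iterDiff supNorm conv ellOp isElliptic_one TorusFRD TorusFRD_holds)
open Literature.MathematicalPhysics.QuantumFieldTheory
open Literature.Dynamics.Hyperbolic

set_option maxHeartbeats 3200000 in
/-- **`FreeEnergyBounds` from the `q`-regularity slots on the shrunk state ball** (module docstring): the
`N`-uniform first and mixed second DIFFERENCE bounds of the finite-volume free energy on the `ι`-admissible ball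
([ABKM19] Thm 2.2, `ℓ ≤ 2`, difference form, `ι`-symmetric complex class), GIVEN `N`-free sizes for the nine
`q`-slots (`F4StatementShrink 4`) and the state slot (`H1bcStatementShrink 4`) of the shrunk form of every `d = 4`
package. [cite: AdamsBuchholzKoteckyMuller2019, Thm 2.2 / proof of Thm 12.1] -/
theorem freeEnergyBounds_of_shrunkSlots (hF4 : F4StatementShrink 4) (hH1 : H1bcStatementShrink 4) :
    FreeEnergyBounds := by
  -- the finite-range decomposition package at `ω₀ = ½`, `Ω₀ = 2`, orders `(16, 19)`
  obtain ⟨𝒞f, Mc, Cα, c, C, Cℓ, hc, hall⟩ :=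
    TorusFRD_holds 4 (by norm_num) (1 / 2) 2 (by norm_num) (by norm_num) 16 19 (by norm_num)
  -- replace `Cℓ` by `max Cℓ 0` (upper bounds survive)
  set Cℓ' : ℕ → ℝ := fun ℓ => max (Cℓ ℓ) 0 with hCℓ'
  have hC1 : 0 ≤ Cℓ' 1 := le_max_right _ _
  have hall' : ∀ L : ℕ, Odd L → 3 < L → ∀ N : ℕ, 1 ≤ N → ∀ (M : ℕ) [NeZero M], M = L ^ N →
      ∀ A : Matrix (Fin 4) (Fin 4) ℝ, IsElliptic (1 / 2 : ℝ) 2 A →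
        (∀ k, 1 ≤ k → k ≤ N + 1 →
          ∑ x : Fin 4 → ZMod M, 𝒞f L N M A k x = 0 ∧ ∀ x, 𝒞f L N M A k (-x) = 𝒞f L N M A k x) ∧
        (∀ k, 1 ≤ k → k ≤ N + 1 → ∀ φ : (Fin 4 → ZMod M) → ℝ, ∑ x, φ x = 0 →
          0 ≤ ∑ x, ∑ y, φ x * 𝒞f L N M A k (x - y) * φ y) ∧
        (∀ φ : (Fin 4 → ZMod M) → ℝ, ∑ x, φ x = 0 →
          ellOp A (conv (fun x => ∑ k ∈ Finset.Icc 1 (N + 1), 𝒞f L N M A k x) φ) = φ) ∧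
        (∀ k, 1 ≤ k → k ≤ N → Mc L N k ≤ 0 ∧
          ∀ x : Fin 4 → ZMod M, ((L : ℝ) ^ k) / 2 ≤ (supNorm x : ℝ) →
            𝒞f L N M A k x = Mc L N k) ∧
        (∀ k, 1 ≤ k → k ≤ N + 1 → ∀ B : Matrix (Fin 4) (Fin 4) ℝ, IsUnitSymm B →
          (∃ ε : ℝ, 0 < ε ∧ ∀ x : Fin 4 → ZMod M,
            ContDiffOn ℝ ⊤ (fun s : ℝ => 𝒞f L N M (A + s • B) k x) (Set.Ioo (-ε) ε)) ∧
          ∀ α : Fin 4 → ℕ, ∑ i, α i ≤ 16 → ∀ ℓ : ℕ, ∀ x : Fin 4 → ZMod M,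
            abs (iteratedDeriv ℓ (fun s : ℝ => iterDiff α (𝒞f L N M (A + s • B) k) x) 0)
              ≤ Cα α ℓ / (L : ℝ) ^ ((k - 1) * (4 - 2 + ∑ i, α i))) ∧
        (∀ k, 1 ≤ k → k ≤ N + 1 → ∀ j : ℕ, ∀ κ : Fin 4 → ZMod M, κ ≠ 0 → InShell L j κ →
          (j < k →
            c / (L : ℝ) ^ (2 * (4 + 19) + 1) * (L : ℝ) ^ (2 * j)
                / (L : ℝ) ^ ((k - j) * (4 - 1 + 16)) ≤ (fourierCoeff (𝒞f L N M A k) κ).re ∧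
            ‖fourierCoeff (𝒞f L N M A k) κ‖
              ≤ C * (L : ℝ) ^ (2 * (4 + 19) + 1) * (L : ℝ) ^ (2 * j)
                  / (L : ℝ) ^ ((k - j) * (4 - 1 + 16))) ∧
          (k ≤ j →
            c / (L : ℝ) ^ (2 * (4 + 19) + 1) * (L : ℝ) ^ (2 * k)
                ≤ (fourierCoeff (𝒞f L N M A k) κ).re ∧
            ‖fourierCoeff (𝒞f L N M A k) κ‖ ≤ C * (L : ℝ) ^ (2 * k)) ∧
          ∀ B : Matrix (Fin 4) (Fin 4) ℝ, IsUnitSymm B → ∀ ℓ : ℕ, 1 ≤ ℓ →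
            (j < k →
              ‖iteratedDeriv ℓ (fun s : ℝ => fourierCoeff (𝒞f L N M (A + s • B) k) κ) 0‖
                ≤ Cℓ' ℓ * (L : ℝ) ^ (2 * (4 + 19) + 1) * (L : ℝ) ^ (2 * j)
                    / (L : ℝ) ^ ((k - j) * (4 - 1 + 19))) ∧
            (k ≤ j →
              ‖iteratedDeriv ℓ (fun s : ℝ => fourierCoeff (𝒞f L N M (A + s • B) k) κ) 0‖
                ≤ Cℓ' ℓ * (L : ℝ) ^ (2 * k))) := by
    intro L hLo hL3 N hN M _ hM A hA
    obtain ⟨h1, h2, h3, h4, h5, h6⟩ := hall L hLo hL3 N hN M hM A hA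
    refine ⟨h1, h2, h3, h4, h5, fun k hk hkN j κ hκ hj => ?_⟩
    obtain ⟨ha, hb, hCℓ⟩ := h6 k hk hkN j κ hκ hj
    have hL0 : (0 : ℝ) ≤ (L : ℝ) := Nat.cast_nonneg L
    refine ⟨ha, hb, fun B hB ℓ hℓ => ⟨fun hjk => ((hCℓ B hB ℓ hℓ).1 hjk).trans ?_,
      fun hkj => ((hCℓ B hB ℓ hℓ).2 hkj).trans ?_⟩⟩
    · have hx : 0 ≤ (L : ℝ) ^ (2 * (4 + 19) + 1) * (L : ℝ) ^ (2 * j) / (L : ℝ) ^ ((k - j) * (4 - 1 + 19)) := by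
        positivity
      have := mul_le_mul_of_nonneg_right (le_max_left (Cℓ ℓ) 0) hx
      simpa [hCℓ', mul_assoc, mul_div_assoc] using this
    · exact mul_le_mul_of_nonneg_right (le_max_left (Cℓ ℓ) 0) (by positivity)
  -- fixed parameters
  have hd : 3 ≤ 4 := by norm_num
  have hθ0' : (0 : ℝ) < 1 / 8 := by norm_num
  have hlam : (0 : ℝ) < 1 / 2 := by norm_num
  -- the weight schedule (Theorem 7.1), per `L`
  have hWpack := abkm_weight_bounds_of_package (d := 4) hd (Mord := 8) (R := 8) (by norm_num) le_rfl (n := 16) (ñ := 19)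
    (by norm_num) (θbar := 1 / 8) (lam := 1 / 2) hθ0' (by norm_num) hlam (by norm_num) hc hall'
  -- the q-step integration constant `A_𝒫' = A_𝒫(θ)` at `θ = 1/16` (independent of `L`)
  set A𝒫' : ℝ := weightIntConstRho (1 / 8) (1 / 16) (traceConst 4 8 8 (1 / 2) (derivSum 4 16 fun θ' _ => Cα θ' 0)) with hA𝒫'def
  have hA𝒫1 : 1 ≤ A𝒫' := one_le_weightIntConstRho hθ0' (by norm_num) (by norm_num)
    (traceConst_nonneg 4 8 8 hlam.le (derivSum_nonneg 4 16 _))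
  have hA𝒫0 : 0 < A𝒫' := by linarith
  -- `L₀`: `L ≥ 256` and `L^4 · A_𝒫' · abkmContrConst 4 L 8 ≤ 1/8`
  have hlim : ∀ᶠ L : ℕ in atTop, (L : ℝ) ^ 4 * abkmContrConst 4 L 8 ≤ 1 / (8 * A𝒫') :=
    (tendsto_pow_mul_abkmContrConst hd 8).eventually (Iic_mem_nhds (by positivity))
  obtain ⟨L₁, hL₁⟩ := Filter.eventually_atTop.1 hlim
  refine ⟨3, max 256 L₁, fun L hLodd hLge => ?_⟩
  have hL256 : 256 ≤ L := le_of_max_le_left hLge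
  have hLL₁ : L₁ ≤ L := le_of_max_le_right hLge
  have hL : 2 ^ (4 + 3) + 16 * 8 ≤ L := by norm_num; omega
  have hL3 : 3 < L := by omega
  have hL0 : (0 : ℝ) < L := by exact_mod_cast hLodd.pos
  haveI : Fact (0 < L) := ⟨hLodd.pos⟩
  have hcontr : (L : ℝ) ^ 4 * (A𝒫' * abkmContrConst 4 L 8) ≤ 1 / 8 := by
    have h := hL₁ L hLL₁
    calc (L : ℝ) ^ 4 * (A𝒫' * abkmContrConst 4 L 8) = A𝒫' * ((L : ℝ) ^ 4 * abkmContrConst 4 L 8) := by ring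
      _ ≤ A𝒫' * (1 / (8 * A𝒫')) := mul_le_mul_of_nonneg_left h hA𝒫0.le
      _ = 1 / 8 := by field_simp
  -- the schedule at this `L`
  obtain ⟨μ, δ₁, δ₀, hμ, hδ₁, hδ₀, hBall⟩ := hWpack L hLodd hL
  -- `h`
  set hsq : ℝ := max (hZeroSq 4 8 δ₀ δ₁) 0 + secondDiffConst (fun θ' => Cα θ' 0) + 1 with hhsq
  have hhsq0 : 0 < hsq := by
    have := secondDiffConst_nonneg (fun θ' => Cα θ' 0)
    have := le_max_right (hZeroSq 4 8 δ₀ δ₁) 0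
    rw [hhsq]; linarith
  set h : ℝ := Real.sqrt hsq with hhdef
  have hh : 0 < h := Real.sqrt_pos.2 hhsq0
  haveI : Fact (0 < h) := ⟨hh⟩
  have hh2eq : h ^ 2 = hsq := Real.sq_sqrt hhsq0.le
  have hh0 : hZeroSq 4 8 δ₀ δ₁ ≤ h ^ 2 := by
    rw [hh2eq, hhsq]
    have := le_max_left (hZeroSq 4 8 δ₀ δ₁) 0
    have := secondDiffConst_nonneg (fun θ' => Cα θ' 0)
    linarith
  have hh2 : secondDiffConst (fun θ' => Cα θ' 0) ≤ h ^ 2 := by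
    rw [hh2eq, hhsq]
    have := le_max_right (hZeroSq 4 8 δ₀ δ₁) 0
    linarith
  -- `T₀`
  set src : ℝ := shellRatioConst c (Cℓ' 1) (L : ℝ) 4 19 with hsrc
  have hsrc0 : 0 ≤ src := shellRatioConst_nonneg hc hC1 hL0.le 4 19
  have hlog : 0 < Real.log (1 + 1 / 16) := Real.log_pos (by norm_num)
  set T₀ : ℝ := min (1 / 2) (Real.log (1 + 1 / 16) / (src + 1)) with hT₀def
  have hT₀pos : 0 < T₀ := lt_min (by norm_num) (div_pos hlog (by linarith))
  have hT₀ : T₀ ≤ 1 / 2 := min_le_left _ _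
  have hKT₀ : src * T₀ ≤ Real.log (1 + (1 / 16 : ℝ)) := by
    calc src * T₀ ≤ src * (Real.log (1 + 1 / 16) / (src + 1)) :=
          mul_le_mul_of_nonneg_left (min_le_right _ _) hsrc0
      _ = (src / (src + 1)) * Real.log (1 + 1 / 16) := by ring
      _ ≤ 1 * Real.log (1 + 1 / 16) := by
          refine mul_le_mul_of_nonneg_right ?_ hlog.le
          rw [div_le_one (by linarith)]; linarith
      _ = Real.log (1 + 1 / 16) := one_mul _
  -- `A`
  set C87 : ℝ := pi2BoundConst 4 (((2 * 8 + 2 : ℕ) : ℝ) + ((4 / 2 + 1 : ℕ) : ℝ)) with hC87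
  have hC870 : 0 ≤ C87 := pi2BoundConst_nonneg 4 (by positivity)
  obtain ⟨A₀, hA₀⟩ := exists_sigmaABKM_zero_lt 4 L 8 A𝒫' (δ := 1 / 8) (by norm_num)
  have hβev : ∀ᶠ A : ℝ in atTop, (L : ℝ) ^ 4 * (C87 * (A𝒫' * A⁻¹)) ≤ 1 / 6 := by
    have ht : Tendsto (fun A : ℝ => (L : ℝ) ^ 4 * (C87 * (A𝒫' * A⁻¹))) atTop (𝓝 0) := by
      have := ((tendsto_inv_atTop_zero.const_mul A𝒫').const_mul C87).const_mul ((L : ℝ) ^ 4)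
      simpa using this
    exact ht.eventually (Iic_mem_nhds (by norm_num))
  obtain ⟨A, ⟨hA1, hA𝒫A, hsmall, hCA⟩, hAA₀, hβ⟩ :=
    ((eventually_atTop_sideConditions 4 L 8 A𝒫').and ((eventually_ge_atTop A₀).and hβev)).exists
  have hA : 0 < A := by linarith
  have hσ0 : sigmaABKM 4 L 8 A A𝒫' 0 < 1 / 4 := by
    have := hA₀ A hAA₀; linarith
  -- `r`
  have hσev : ∀ᶠ r : ℝ in 𝓝 0, sigmaABKM 4 L 8 A A𝒫' r < 7 / 16 :=
    (continuous_sigmaABKM 4 L 8 A A𝒫').continuousAt.eventually_lt continuousAt_const (by linarith)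
  obtain ⟨δ, hδ, hδball⟩ := Metric.eventually_nhds_iff.1 ((eventually_nhds_ballConditions 4 8 A A𝒫').and hσev)
  set r : ℝ := min (δ / 2) (1 / 64) with hrdef
  have hr0 : 0 < r := lt_min (by linarith) (by norm_num)
  have hr : r ≤ 1 / 64 := min_le_right _ _
  have hrδ : dist r 0 < δ := by
    rw [Real.dist_eq, sub_zero, abs_of_pos hr0]
    exact (min_le_left _ _).trans_lt (by linarith)
  obtain ⟨⟨hv, hωA⟩, hσr⟩ := hδball hrδ
  have hrδ8 : dist (r / 8) 0 < δ := by
    rw [Real.dist_eq, sub_zero, abs_of_pos (by positivity : (0 : ℝ) < r / 8)]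
    have : r / 8 ≤ r := by linarith
    exact (this.trans (min_le_left _ _)).trans_lt (by linarith)
  obtain ⟨-, hσr8⟩ := hδball hrδ8
  have hv0 : 0 ≤ vABKM 4 8 A A𝒫' r := vABKM_nonneg hA hA𝒫0.le hr0.le
  obtain ⟨hc3A, hc2A⟩ := hCA r hr0.le hr hv0 hv
  -- the package, bundled
  let P : PackageData 4 :=
    { L := L, Mord := 8, R := 8, n := 16, ñ := 19, pT := 4, r₀ := 3, θbar := 1 / 8, lam := 1 / 2, μ := μ, δ₁ := δ₁,
      δ₀ := δ₀, A𝒫 := weightIntConst (1 / 8) (traceConst 4 8 8 (1 / 2) (derivSum 4 16 fun θ' _ => Cα θ' 0)),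
      c := c, C := C, Cℓ := Cℓ', Cα := Cα, h := h, θ := 1 / 16, T₀ := T₀, A𝒫' := A𝒫', A := A, r := r,
      hh := hh, hd := hd, hMord := by norm_num, hMR := le_rfl, hLodd := hLodd, hL := hL, hR2 := by norm_num,
      hθbar := hθ0', hlam := hlam, hn := by norm_num, hn2 := by norm_num, hnñ := by norm_num, hgap := by norm_num,
      hc := hc, hC1 := hC1, hp := by norm_num, hpM := by norm_num, hr₀ := le_rfl, hδ₀ := hδ₀, hδ₁ := hδ₁, hh0 := hh0,
      hh2 := hh2, hθ0 := by norm_num, hθ := by norm_num, hT₀ := hT₀, hKT₀ := hKT₀, hA𝒫' := hA𝒫'def.symm, hA1 := hA1,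
      hA𝒫A := hA𝒫A, hsmall := hsmall, hr0 := hr0.le, hr := hr, hv := hv, hωA := hωA, hc3A := hc3A, hc2A := hc2A }
  haveI : Fact (0 < P.h) := ⟨hh⟩
  haveI : Fact (0 < P.L) := ⟨hLodd.pos⟩
  -- the `N`-free sizes of the slots
  obtain ⟨aT, bT, lT, aTT, bTT, lTT, lT', φT, φTT, haT, hbT, hlT, haTT, hbTT, hlTT, hlT', hφT, hφTT, hslots⟩ := hF4 P
  obtain ⟨σ₂, hσ₂, hstate⟩ := hH1 P
  -- the per-`L` side conditions in the vocabulary of the SHRUNK package `P.shrink` (radius `r/8`)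
  have hβP : (P.shrink.L : ℝ) ^ 4 *
      (pi2BoundConst 4 (((2 * P.shrink.R + 2 : ℕ) : ℝ) + ((4 / 2 + 1 : ℕ) : ℝ)) * (P.shrink.A𝒫' * P.shrink.A⁻¹)) ≤ 1 / 6 := by
    show (L : ℝ) ^ 4 * (pi2BoundConst 4 (((2 * 8 + 2 : ℕ) : ℝ) + ((4 / 2 + 1 : ℕ) : ℝ)) * (A𝒫' * A⁻¹)) ≤ 1 / 6
    rw [← hC87]; exact hβ
  have hσP : sigmaABKM 4 P.shrink.L P.shrink.R P.shrink.A P.shrink.A𝒫' P.shrink.r ≤ 7 / 16 := by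
    show sigmaABKM 4 L 8 A A𝒫' (r / 8) ≤ 7 / 16
    exact hσr8.le
  have hr8 : 0 < P.shrink.r := by show 0 < r / 8; positivity
  have hT₀P : 0 < P.shrink.T₀ := by show 0 < T₀; exact hT₀pos
  obtain ⟨ρK, Cst, hρK, hCst, hallN⟩ := freeEnergy_allN_of_slots P.shrink hr8 hT₀P
    (by show 4 * 4 ≤ 2 ^ (4 + 2); norm_num) hβP hσP haT hbT hlT haTT hbTT hlTT hlT' hφT hφTT hσ₂ hslots hstate
  -- now every `N`
  refine ⟨ρK, Cst, hρK, hCst, fun N hN n _ hn => ?_⟩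
  let Q : PackageAt P.shrink N n :=
    { 𝒞 := 𝒞f L N n, Mc := Mc L N, hN := hN, hM := hn, hallA := hall' L hLodd hL3 N hN n hn, hB := hBall N hN n hn }
  exact hallN N n Q

end Summit.HubbardSuperconductivity.HubbardSuperconductivity.Theorems.ComplexGFF

end
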